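import Summits.CriticalPhenomena.CardyFormulaZ2.Theorems.CardyBoundaryCoulombGasBoundaryDefectGaussianRStubRealisabilityPart38
import Summits.CriticalPhenomena.CardyFormulaZ2.Theorems.CardyBoundaryCoulombGasBoundaryDefectGaussianRStubRealisabilityPart46
import Literature.Probability.LatticeModels.CollarLegModelConfigs

/-!
# Stub `stub_rainbowNonempty` of line `rainbow-monomials-in-excursion-kernels` — D2 completion,
# sub-goal `s17_rainbow_of_config`: the equal-endpoint live edges of a valid height configuration
# form a rainbow configuration
# (crux `BoundaryDefectGaussianR`, stmt-CriticalPhenomena-14132; insertion dictionary D2, layer 4)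

The insertion dictionary D2 reads `‖Zins V ι‖ = #{ω ⊆ E : Rainbow ι V ω}`. This file proves the
"easy direction" used by the rainbow witness of the D2 completion skeleton: for an ADMISSIBLE leg
insertion `ι` on `V` whose insertion points are FLAT at radius `sinkLegs + 4` and whose boundary
vertices carry radius-`3` CHARTS, every VALID height configuration `h ∈ (ι.model V).configs` of the
jump collar makes the set

  `ω_h = {e ∈ E : hv h e.1 = hv h (edgeTip e)}`

of live edges whose two endpoints carry the same height a RAINBOW configuration (`ι.Rainbow V ω_h`).

Proof (`rainbow_of_config`). By Lemma V (`unitDifferences_live`, Part 46) the four corners of every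
live edge `e` carry unit height differences. Every corner with a live target is `cIn e` or `cOut e`
for a live `e` (`exists_eq_cIn_or_cOut`, Part 19), and `e` is present in the completed
configuration `cfgOf ω_h` iff `e ∈ ω_h` (live edges are never frozen open). If `e ∈ ω_h` the turn
follows the edge and compares the two endpoint heights — equal by the definition of `ω_h`; if
`e ∉ ω_h` it crosses the edge and compares the two side faces `p, q`: from
`|a - p| = |a - q| = |b - p| = |b - q| = 1` and `a ≠ b` (the endpoint heights) we get `p = q`. So every
live turn is consistent for `(h, cfgOf ω_h)`, and the rainbow forcing with all strand-end inputs
discharged (`tc_rainbow_of_consistent`, Part 38; its flatness radius `sinkLegs + 3` follows from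
radius `sinkLegs + 4`) gives `ι.Rainbow V ω_h`. Registered one-line form: `s17_rainbow_of_config`.
-/

namespace Summit.CriticalPhenomena.CardyFormulaZ2.Cruxes.BoundaryDefectGaussianR.RainbowMonomialsInExcursionKernels

open Finset Literature.Probability.LatticeModels Literature.Probability.LatticeModels.CollarLegModel

/-- Flatness of the insertion points at radius `sinkLegs + 4` implies flatness at radius
`sinkLegs + 3` (the ball of radius `L + 3` lies in the ball of radius `L + 4`). [folklore] -/
theorem flat3_of_flat4 (ι : LegInsertionData) (V : Finset (ℤ × ℤ))
    (hflat : ∀ x ∈ insert ι.sink ι.source, ∃ dvec : ℤ × ℤ,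
      (dvec = (1, 0) ∨ dvec = (-1, 0) ∨ dvec = (0, 1) ∨ dvec = (0, -1)) ∧
      ∀ v : ℤ × ℤ, (v.1 - x.1) ^ 2 + (v.2 - x.2) ^ 2 ≤ ((ι.sinkLegs : ℤ) + 4) ^ 2 →
        (v ∈ V ↔ 0 ≤ (v.1 - x.1) * dvec.1 + (v.2 - x.2) * dvec.2)) :
    ∀ x ∈ insert ι.sink ι.source, ∃ dvec : ℤ × ℤ,
      (dvec = (1, 0) ∨ dvec = (-1, 0) ∨ dvec = (0, 1) ∨ dvec = (0, -1)) ∧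
      ∀ v : ℤ × ℤ, (v.1 - x.1) ^ 2 + (v.2 - x.2) ^ 2 ≤ ((ι.sinkLegs : ℤ) + 3) ^ 2 →
        (v ∈ V ↔ 0 ≤ (v.1 - x.1) * dvec.1 + (v.2 - x.2) * dvec.2) := by
  intro x hx
  obtain ⟨dvec, hd, hV⟩ := hflat x hx
  refine ⟨dvec, hd, fun v hv => hV v (le_trans hv ?_)⟩
  have hL : (0 : ℤ) ≤ (ι.sinkLegs : ℤ) := Int.natCast_nonneg _
  nlinarith

/-- The side faces of a live edge are forced equal by the closed pairing: for four heights
`a, b` (endpoints) and `p, q` (side faces) at unit distance across the four corners, `a ≠ b`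
implies `p = q`. [cite: BaxterKellandWu1976, §4] -/
theorem faces_eq_of_ne_of_units {a b p q : ℤ} (h1 : |a - p| = 1) (h2 : |a - q| = 1) (h3 : |b - p| = 1)
    (h4 : |b - q| = 1) (hab : a ≠ b) : p = q := by
  rw [abs_eq (zero_le_one' ℤ)] at h1 h2 h3 h4
  omega

/-- **Every live turn is consistent for the equal-endpoint pairing.** For a collar leg model `M`,
a height configuration `h` with unit differences around every live edge, and
`ω_h = {e ∈ E : hv h e.1 = hv h (edgeTip e)}`: every corner with a live target is a consistent
turn of `(h, cfgOf ω_h)` — along `e ∈ ω_h` the two endpoint heights agree by definition, across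
`e ∉ ω_h` the two side-face heights agree by `faces_eq_of_ne_of_units`. [cite: BaxterKellandWu1976, §4] -/
theorem turnConsistent_of_targetsLive_pairing (M : CollarLegModel) (h : ↥M.freeCells → ℤ)
    (hunit : ∀ e ∈ M.E, |M.hv h e.1 - M.hf h (SixVertex.leftFace e false)| = 1 ∧
      |M.hv h e.1 - M.hf h (SixVertex.leftFace e true)| = 1 ∧
      |M.hv h (SixVertex.edgeTip e) - M.hf h (SixVertex.leftFace e false)| = 1 ∧
      |M.hv h (SixVertex.edgeTip e) - M.hf h (SixVertex.leftFace e true)| = 1)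
    (c : Site 2 × Fin 4) (hl : M.TargetsLive c) :
    M.TurnConsistent h (M.cfgOf (M.E.filter (fun e => M.hv h e.1 = M.hv h (SixVertex.edgeTip e)))) c := by
  set ω := M.E.filter (fun e => M.hv h e.1 = M.hv h (SixVertex.edgeTip e)) with hω
  obtain ⟨e, hc⟩ := exists_eq_cIn_or_cOut c
  have hedge : cTgt c = edgeSym2 e := by
    rcases hc with rfl | rfl
    exacts [cTgt_cIn e, cTgt_cOut e]
  have he : e ∈ M.E := by
    rcases hc with rfl | rfl
    exacts [(M.targetsLive_cIn_iff e).1 hl, (M.targetsLive_cOut_iff e).1 hl]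
  have he' : e.1 ∈ M.V ∧ SixVertex.edgeTip e ∈ M.V := by
    have := he; rw [E, inducedEdges, mem_filter] at this; exact this.2
  have hx := M.mem_vertexCells_of_mem he'.1
  have hy := M.mem_vertexCells_of_mem he'.2
  have hfF := M.leftFace_mem_faceCells he'.1 false
  have hfT := M.leftFace_mem_faceCells he'.1 true
  obtain ⟨v1, v2, v3, v4⟩ := hunit e he
  have hmem : cTgt c ∈ M.cfgOf ω ↔ e ∈ ω := by
    rw [hedge, edgeSym2_mem_cfgOf_iff]
    exact ⟨fun h' => h'.elim id (fun ho => absurd ho (M.not_mem_openEdges_of_mem_E he)), Or.inl⟩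
  by_cases heω : e ∈ ω
  · -- open pairing: the level line follows `e`; the two endpoint heights agree by definition of `ω`
    have hm : cTgt c ∈ M.cfgOf ω := hmem.2 heω
    have heq : M.hv h e.1 = M.hv h (SixVertex.edgeTip e) := (mem_filter.1 heω).2
    refine ⟨?_, ?_, fun _ => ?_, fun hn => absurd hm hn⟩
    · rcases hc with rfl | rfl
      · exact ⟨by rw [ofSite_cIn_fst]; exact hx, by rw [ofSite_cFace_cIn]; exact hfF⟩
      · exact ⟨by rw [ofSite_cOut_fst]; exact hy, by rw [ofSite_cFace_cOut]; exact hfT⟩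
    · rw [nextCorner_of_mem hm]
      rcases hc with rfl | rfl
      · exact ⟨by rw [ofSite_cIn_fst_add]; exact hy, by rw [ofSite_cFace_cIn_open]; exact hfF⟩
      · exact ⟨by rw [ofSite_cOut_fst_add]; exact hx, by rw [ofSite_cFace_cOut_open]; exact hfT⟩
    · rw [nextCorner_of_mem hm]
      rcases hc with rfl | rfl
      · rw [ofSite_cIn_fst, ofSite_cIn_fst_add]; exact heq
      · rw [ofSite_cOut_fst, ofSite_cOut_fst_add]; exact heq.symm
  · -- closed pairing: the level line crosses `e`; the two side faces agree by the unit differences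
    have hm : cTgt c ∉ M.cfgOf ω := fun h' => heω (hmem.1 h')
    have hne : M.hv h e.1 ≠ M.hv h (SixVertex.edgeTip e) := fun h' => heω (mem_filter.2 ⟨he, h'⟩)
    have hpq : M.hf h (SixVertex.leftFace e false) = M.hf h (SixVertex.leftFace e true) :=
      faces_eq_of_ne_of_units v1 v2 v3 v4 hne
    refine ⟨?_, ?_, fun h' => absurd h' hm, fun _ => ?_⟩
    · rcases hc with rfl | rfl
      · exact ⟨by rw [ofSite_cIn_fst]; exact hx, by rw [ofSite_cFace_cIn]; exact hfF⟩
      · exact ⟨by rw [ofSite_cOut_fst]; exact hy, by rw [ofSite_cFace_cOut]; exact hfT⟩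
    · rw [nextCorner_of_not_mem hm]
      rcases hc with rfl | rfl
      · exact ⟨by rw [ofSite_cIn_fst]; exact hx, by rw [ofSite_cFace_cIn_succ]; exact hfT⟩
      · exact ⟨by rw [ofSite_cOut_fst]; exact hy, by rw [ofSite_cFace_cOut_succ]; exact hfF⟩
    · rw [nextCorner_of_not_mem hm]
      rcases hc with rfl | rfl
      · rw [ofSite_cFace_cIn, ofSite_cFace_cIn_succ]; exact hpq
      · rw [ofSite_cFace_cOut, ofSite_cFace_cOut_succ]; exact hpq.symm

/-- **The equal-endpoint live edges of a valid configuration form a rainbow configuration.** For an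
ADMISSIBLE leg insertion `ι` on `V` with insertion points FLAT at radius `sinkLegs + 4` and
radius-`3` CHARTS at the boundary vertices of `V`, and every valid height configuration `h` of the
jump collar `ι.model V`, the set `ω_h = {e ∈ E : hv h e.1 = hv h (edgeTip e)}` is rainbow:
Lemma V (unit differences, Part 46) makes every live turn consistent for `(h, cfgOf ω_h)`
(`turnConsistent_of_targetsLive_pairing`), and the rainbow forcing `tc_rainbow_of_consistent`
(Part 38) concludes. [cite: BaxterKellandWu1976, §3–§4] -/
theorem rainbow_of_config (ι : LegInsertionData) (V : Finset (ℤ × ℤ)) (hadm : ι.IsAdmissible V)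
    (hflat : ∀ x ∈ insert ι.sink ι.source, ∃ dvec : ℤ × ℤ,
      (dvec = (1, 0) ∨ dvec = (-1, 0) ∨ dvec = (0, 1) ∨ dvec = (0, -1)) ∧
      ∀ v : ℤ × ℤ, (v.1 - x.1) ^ 2 + (v.2 - x.2) ^ 2 ≤ ((ι.sinkLegs : ℤ) + 4) ^ 2 →
        (v ∈ V ↔ 0 ≤ (v.1 - x.1) * dvec.1 + (v.2 - x.2) * dvec.2))
    (hchart : ∀ u ∈ V, ∀ k : Fin 4, u + dir k ∉ V → ∃ (K : Fin 4) (c₁ c₂ : ℤ),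
      (∀ v : ℤ × ℤ, |v.1 - u.1| ≤ 3 → |v.2 - u.2| ≤ 3 →
        (v ∈ V ↔ c₂ ≤ v.1 * (dir (K + 1)).1 + v.2 * (dir (K + 1)).2)) ∨
      (∀ v : ℤ × ℤ, |v.1 - u.1| ≤ 3 → |v.2 - u.2| ≤ 3 →
        (v ∈ V ↔ c₁ ≤ v.1 * (dir K).1 + v.2 * (dir K).2 ∧
          c₂ ≤ v.1 * (dir (K + 1)).1 + v.2 * (dir (K + 1)).2)) ∨
      (∀ v : ℤ × ℤ, |v.1 - u.1| ≤ 3 → |v.2 - u.2| ≤ 3 →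
        (v ∈ V ↔ c₂ ≤ v.1 * (dir (K + 1)).1 + v.2 * (dir (K + 1)).2 ∨
          v.1 * (dir K).1 + v.2 * (dir K).2 ≤ c₁)))
    (h : ↥(ι.model V).freeCells → ℤ) (hh : h ∈ (ι.model V).configs) :
    ι.Rainbow V (((ι.model V).E).filter
      (fun e => (ι.model V).hv h e.1 = (ι.model V).hv h (SixVertex.edgeTip e))) := by
  have hval : (ι.model V).IsValid h := (mem_configs_iff_isValid (ι.model V) h).1 hh
  have hunit := unitDifferences_live V ι hadm hflat (chart8_of_chart3 hchart) h hval
  exact tc_rainbow_of_consistent ι V hadm (flat3_of_flat4 ι V hflat) hchart (hh := h) (filter_subset _ _)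
    (fun c _ hl => turnConsistent_of_targetsLive_pairing (ι.model V) h hunit c hl) hval

/-! ### Registered one-line form -/

/-- **Sub-goal `s17_rainbow_of_config`** (registered on stmt-CriticalPhenomena-14132; D2 completion,
finite core of the rainbow witness W2): for an ADMISSIBLE leg insertion `ι` on `V` with insertion
points FLAT at radius `sinkLegs + 4` and radius-`3` CHARTS at the boundary vertices, every valid
height configuration `h ∈ (ι.model V).configs` makes the set of live edges with equal endpoint
heights a RAINBOW configuration. [cite: BaxterKellandWu1976, §3–§4] -/
theorem s17_rainbow_of_config : ∀ (ι : Literature.Probability.LatticeModels.CollarLegModel.LegInsertionData) (V : Finset (ℤ × ℤ)), ι.IsAdmissible V → (∀ x ∈ insert ι.sink ι.source, ∃ dvec : ℤ × ℤ, (dvec = (1, 0) ∨ dvec = (-1, 0) ∨ dvec = (0, 1) ∨ dvec = (0, -1)) ∧ ∀ v : ℤ × ℤ, (v.1 - x.1) ^ 2 + (v.2 - x.2) ^ 2 ≤ ((ι.sinkLegs : ℤ) + 4) ^ 2 → (v ∈ V ↔ 0 ≤ (v.1 - x.1) * dvec.1 + (v.2 - x.2) * dvec.2)) → (∀ u ∈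 V, ∀ k : Fin 4, u + Literature.Probability.LatticeModels.CollarLegModel.dir k ∉ V → ∃ (K : Fin 4) (c₁ c₂ : ℤ), (∀ v : ℤ × ℤ, |v.1 - u.1| ≤ 3 → |v.2 - u.2| ≤ 3 → (v ∈ V ↔ c₂ ≤ v.1 * (Literature.Probability.LatticeModels.CollarLegModel.dir (K + 1)).1 + v.2 * (Literature.Probability.LatticeModels.CollarLegModel.dir (K + 1)).2)) ∨ (∀ v : ℤ × ℤ, |v.1 - u.1| ≤ 3 → |v.2 - u.2| ≤ 3 → (v ∈ V ↔ c₁ ≤ v.1 * (Literature.Probability.LatticeModels.CollarLegModel.dir K).1 + v.2 * (Literature.Probability.LatticeModels.CollarLegModel.dir K).2 ∧ c₂ ≤ v.1 * (Literature.Probability.LatticeModels.CollarLegModel.dir (K + 1)).1 + v.2 * (Literature.Probability.LatticeModels.CollarLegModel.dir (K + 1)).2)) ∨ (∀ v : ℤ × ℤ, |v.1 - u.1| ≤ 3 → |v.2 - u.2| ≤ 3 → (v ∈ V ↔ c₂ ≤ v.1 * (Literature.Probability.LatticeModels.CollarLegModel.dir (K + 1)).1 + v.2 * (Literature.Probability.LatticeModels.CollarLegModel.dir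 (K + 1)).2 ∨ v.1 * (Literature.Probability.LatticeModels.CollarLegModel.dir K).1 + v.2 * (Literature.Probability.LatticeModels.CollarLegModel.dir K).2 ≤ c₁))) → ∀ h ∈ (ι.model V).configs, ι.Rainbow V (((ι.model V).E).filter (fun e => (ι.model V).hv h e.1 = (ι.model V).hv h (Literature.Probability.LatticeModels.SixVertex.edgeTip e))) :=
  fun ι V hadm hflat hchart h hh => rainbow_of_config ι V hadm hflat hchart h hh

end Summit.CriticalPhenomena.CardyFormulaZ2.Cruxes.BoundaryDefectGaussianR.RainbowMonomialsInExcursionKernels
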